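import Literature.NumberTheory.Automorphic.CDTTheorem722
import Literature.NumberTheory.Automorphic.CDTTheorem712TwoLiftsProofs
import Literature.NumberTheory.Automorphic.FLSModularityLiftingTheorem
import Literature.NumberTheory.Automorphic.FLSResidualImageCriteria
import Literature.NumberTheory.Automorphic.GL2AdelicWeightVectors
import Literature.NumberTheory.Automorphic.AutomorphicRepsGL2WeightOneHeckeEigenform
import Literature.NumberTheory.Automorphic.GL2NewvectorExistence
import Literature.NumberTheory.EllipticCurves.NewformsMainLemmaProofs
import Literature.NumberTheory.EllipticCurves.NewformsLiftProofs
import Literature.NumberTheory.Automorphic.CDTTheorem722SerreProofs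
import Literature.NumberTheory.EllipticCurves.IsogenyFrobeniusTraceHoldsProofs
import Literature.NumberTheory.EllipticCurves.GlobalMinimalModelProofs
import Literature.NumberTheory.EllipticCurves.LFunctionSmulProofs
import Literature.NumberTheory.EllipticCurves.SzpiroOfAbcProofs
import Literature.NumberTheory.EllipticCurves.MatarNekovar2019.IrreducibleOverQuadraticFieldClauseThreeProofs
import Literature.RepresentationTheory.Semisimple.BurnsideMatrixSpan
import Literature.NumberTheory.GaloisRepresentations.AbsolutelyIrreducibleReductionBridge
import Summits.ABC.ABC.Theorems.DefiniteXiFreyModularityStubAbsIrrNegThreeGroup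
import Literature.NumberTheory.GaloisRepresentations.UniversalDeformationHeckeAlgebraExists
import HarnessLib

/-!
# Stub-ideation k1, GEN 6 (2026-08-31) for `stub_liftThree` (crux stmt-ABC-11340 `FreyModularity`, line `Sketch`)

Backs `STUB-IDEAS-stub_liftThree-1.md` (gen 6, supersedes gens 1–5), HOME FAMILY 1 (RECOGNISE &
IMPORT).  Gen 6 = **the landable 0-sorry core + one new negative import certificate**:

* §0–§2 = gen 5's §0–§2 VERBATIM (all PROVED): the stub's registered signature `SigStubLiftThree`,
  the closers from the two most-consumed carriers — W0 `exists_isNewformOf` (BCDT Thm. A) and the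
  SEAT W0′ `BCDT.CDT_theorem_7_2_1` (CDT 1999 Thm. 7.2.1 ⊇ Diamond 1996 Thm. 5.3 at `ℓ = 3`) — the
  image / model lemmas R0 R1 D1 D1b B4 B6, and the fact-web edge W1
  `FLS2015_theorem3 → B3 → IsModularOfAbsIrrThree → CDT_theorem_7_2_1 → stub`.  Gen 5's §3
  (the sorried weight `1 ↦ 2` dictionary ports, which belong to `stub_threeImpTwo`'s B3 debt) is
  DROPPED so that this file has NO `sorry` and can be landed as is `--supports stmt-ABC-11340`.
* §3 (NEW) N1 = a kernel-checked NEGATIVE IMPORT: the tree's newest `R = T` interface, the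
  Fouquet–Wan universal-deformation Hecke algebra (`UniversalDeformationHeckeAlgebra.nonempty`,
  2026-08-27, under `FouquetWan2021Assumption21 p ρ̄`), cannot seat this stub: at `p = 3` with
  `k = 𝔽₃` every unit of `𝔽₃` is an involution, so for an `𝔽₃`-rational extension
  `0 → χ₁ → ρ̄|G₃ → χ₂ → 0` one has `χ₁⁻¹χ₂ = χ₁χ₂ = det ρ̄|G₃ = χ̄₃|G₃`, i.e. clause (2) of
  Assumption 2.1 ("`χ₁⁻¹χ₂ ∉ {1, χ̄_cyc}`") FAILS — and `ρ̄_{E,3}|G₃` IS such an extension for every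
  `E` ordinary or multiplicative at `3` (Serre 1972 §1.11–1.12), which `9 ∤ N_E` allows.  Typed as
  N1a (`(ZMod 3)ˣ` involutive), N1b (characters), N1c (`¬ FouquetWan2021Assumption21 3 ρ̄` from a
  triangular `𝔽₃`-frame with `χ₁χ₂ = χ̄₃`), N1d (the same for any framed model of `E[3]`, the
  determinant supplied by the tree's PROVED `det_eq_modPCyclotomicCharacter_of_isTorsionGaloisRep_holds`).

`lean check` target: rc 0, 0 sorries.
-/

set_option autoImplicit false
set_option linter.dupNamespace false

noncomputable section

open scoped MatrixGroups NumberField Polynomial ModularForm Classical -- `Classical`: `NormedCommRing (mixedSpace ℚ)` for `AutomorphyDatum.gl`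
open Polynomial NumberField IsDedekindDomain
open Literature.NumberTheory.EllipticCurves
open Literature.NumberTheory.EllipticCurves.ModularForms
open Literature.NumberTheory.Automorphic
open Literature.NumberTheory.Automorphic.BCDT
open Literature.NumberTheory.Automorphic.GL2Real
open Literature.NumberTheory.GaloisRepresentations
open Literature.RepresentationTheory.Semisimple
open CongruenceSubgroup Rat.HeightOneSpectrum

universe v

namespace Summit.ABC.ABC.Cruxes.FreyModularity.Sketch.StubIdeas1g6

attribute [local instance] neZero_natGenerator

/-! ## §0  The stub and its two-line closers from the two most-consumed carriers -/

/-- The registered signature of `stub_liftThree` (verbatim copy; the stub itself is not re-typed). -/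
def SigStubLiftThree : Prop :=
  ∀ (W : WeierstrassCurve ℚ) [W.IsElliptic] (ρ : ModPGaloisRep ℚ (ZMod 3) 2),
    W.IsTorsionGaloisRep 3 ρ → ρ.IsAbsIrreducibleOverSqrt (-3) → ¬ 9 ∣ W.conductorNorm ℤ →
    ρ.IsModular → W.IsModularGaloisRepTate 3

/-- **W0 (PROVED).** The umbrella carrier: BCDT Theorem A in the tree's form
`exists_isNewformOf` (336 Literature consumers) closes the stub via the tree's (1) ⇒ (4)
`isModularGaloisRepTate_of_exists_isNewformOf`; every binder but `W` unused.
[cite: BCDTJAMS2001, Thm. A] -/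
theorem stub_liftThree_of_exists_isNewformOf (hA : exists_isNewformOf) : SigStubLiftThree := by
  intro W _ ρ _ _ _ _
  haveI : Fact (Nat.Prime 3) := ⟨Nat.prime_three⟩
  exact isModularGaloisRepTate_of_exists_isNewformOf hA W 3

/-- Calibration: the umbrella carrier trivially implies the seat (`27 ∤ N_E` and `ρ̄` unused).
[cite: ConradDiamondTaylor1999, Thm. 7.2.1] -/
theorem CDT_theorem_7_2_1_of_exists_isNewformOf (hA : exists_isNewformOf) : CDT_theorem_7_2_1 :=
  fun W _ _ _ _ _ _ ↦ exists_isNewformOf_iff.mp hA W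

/-- **W0′ (PROVED; = `Lines/Sketch.lean`'s `stub_liftThree_of_CDT_theorem_7_2_1`).** The SEAT:
`CDT_theorem_7_2_1` closes the stub in one line (`9 ∤ N ⇒ 27 ∤ N`; `ρ̄ modular` unused).
[cite: ConradDiamondTaylor1999, Thm. 7.2.1] -/
theorem stub_liftThree_of_CDT_theorem_7_2_1 (h : CDT_theorem_7_2_1) : SigStubLiftThree :=
  fun W _ ρ hρ hirr h9 _ ↦
    lift_three_of_CDT_theorem_7_2_1 h W ρ hρ hirr fun h27 ↦ h9 (dvd_trans (by norm_num) h27)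

/-! ## §1  (carried over from gen 4, PROVED) image lemmas R1, D1b, R0, D1 and bridges B4, B6 -/

section Image

variable {G : Type*} [Group G] [TopologicalSpace G] {H₁ : Type*} [Group H₁] [TopologicalSpace H₁]
  {H₂ : Type*} [Group H₂] [TopologicalSpace H₂] {A : Type v} [Field A] [TopologicalSpace A] {n : ℕ}

/-- **R1 (PROVED, gen 4).** Absolute irreducibility of a pull-back is monotone in the image
(Burnside, `span_eq_top_iff_forall_isIrreducible`). [folklore] -/
theorem isAbsolutelyIrreducible_comp_of_range_subset (hn : 0 < n) (ρ : FramedRep G A n)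
    (φ₁ : H₁ →ₜ* G) (φ₂ : H₂ →ₜ* G) (hle : Set.range φ₁ ⊆ Set.range φ₂)
    (h : FramedRep.IsAbsolutelyIrreducible (ρ.comp φ₁)) :
    FramedRep.IsAbsolutelyIrreducible (ρ.comp φ₂) := by
  have h1 := (span_eq_top_iff_forall_isIrreducible hn
    ((ρ.comp φ₁ : FramedRep H₁ A n) : H₁ →* GL (Fin n) A)).2 h
  refine (span_eq_top_iff_forall_isIrreducible hn
    ((ρ.comp φ₂ : FramedRep H₂ A n) : H₂ →* GL (Fin n) A)).1 (eq_top_iff.2 ?_)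
  rw [← h1]
  refine Submodule.span_mono ?_
  rintro _ ⟨x, rfl⟩
  obtain ⟨y, hy⟩ := hle ⟨x, rfl⟩
  refine ⟨y, ?_⟩
  change ((ρ (φ₂ y) : GL (Fin n) A) : Matrix (Fin n) (Fin n) A) =
    ((ρ (φ₁ x) : GL (Fin n) A) : Matrix (Fin n) (Fin n) A)
  rw [hy]

/-- **D1b (PROVED, gen 4).** Absolute irreducibility is invariant under a change of frame. [folklore] -/
theorem isAbsolutelyIrreducible_conj [IsTopologicalRing A] (hn : 0 < n) (P : GL (Fin n) A)
    {ρ : FramedRep G A n} (h : ρ.IsAbsolutelyIrreducible) :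
    FramedRep.IsAbsolutelyIrreducible (FramedRep.conj P ρ) := by
  have h1 := (span_eq_top_iff_forall_isIrreducible hn (ρ : G →* GL (Fin n) A)).2 h
  refine (span_eq_top_iff_forall_isIrreducible hn
    ((FramedRep.conj P ρ : FramedRep G A n) : G →* GL (Fin n) A)).1 ?_
  have hfun : (fun g => (((FramedRep.conj P ρ : FramedRep G A n) : G →* GL (Fin n) A) g :
      Matrix (Fin n) (Fin n) A)) = fun g =>
      ((P⁻¹⁻¹ : GL (Fin n) A) : Matrix (Fin n) (Fin n) A) *
        ((ρ g : GL (Fin n) A) : Matrix (Fin n) (Fin n) A) * ((P⁻¹ : GL (Fin n) A) : Matrix _ _ A) := by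
    funext g
    rw [inv_inv]
    rfl
  rw [hfun, span_range_units_conj_eq_top_iff]
  exact h1

end Image

/-- **R0 (PROVED, gen 4).** `Γ_{ℚ(√-3)} ⊆ Γ_{ℚ(ζ₃)}` inside `Γ_ℚ`. [folklore] -/
theorem range_absGaloisRestrict_sqrt_subset_cyclotomic
    (L₁ : Type*) [Field L₁] [Algebra ℚ L₁] [IsSplittingField ℚ L₁ (X ^ 2 - C (-3 : ℚ))]
    (L₂ : Type*) [Field L₂] [Algebra ℚ L₂] [IsCyclotomicExtension {3} ℚ L₂] :
    Set.range (absGaloisRestrict ℚ L₁) ⊆ Set.range (absGaloisRestrict ℚ L₂) := by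
  intro γ hγ
  haveI : Fact (Nat.Prime 3) := ⟨Nat.prime_three⟩
  haveI : NeZero ((3 : ℕ) : ℚ) := ⟨by norm_num⟩
  obtain ⟨τ, hτ⟩ := MonoidHom.mem_range.1 ((mem_range_absGaloisRestrict_cyclotomic_iff 3 L₂ γ).2
    (Summit.ABC.ABC.Theorems.modPCyclotomicCharacter_three_eq_one_of_mem_range L₁ hγ))
  exact ⟨τ, hτ⟩

/-- `restrictField` commutes with a change of frame (definitional). [folklore] -/
theorem restrictField_conj {K : Type*} [Field K] {A : Type*} [Field A] [TopologicalSpace A]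
    [IsTopologicalRing A] {n : ℕ} (L : Type*) [Field L] [Algebra K L] (P : GL (Fin n) A)
    (ρ : FramedGaloisRep K A n) :
    FramedGaloisRep.restrictField L (FramedRep.conj P ρ) =
      FramedRep.conj P (FramedGaloisRep.restrictField L ρ) := rfl

/-- **D1 core (PROVED, gen 4)** over variable models. [folklore] -/
theorem isAbsolutelyIrreducible_restrictField_cyclotomic_of_sqrt
    {L₁ : Type*} [Field L₁] [Algebra ℚ L₁] [IsSplittingField ℚ L₁ (X ^ 2 - C (-3 : ℚ))]
    (L₂ : Type*) [Field L₂] [Algebra ℚ L₂] [IsCyclotomicExtension {3} ℚ L₂]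
    (ρ : ModPGaloisRep ℚ (ZMod 3) 2) (P : GL (Fin 2) (ZMod 3))
    (h : FramedRep.IsAbsolutelyIrreducible (FramedGaloisRep.restrictField L₁ ρ)) :
    FramedRep.IsAbsolutelyIrreducible (FramedGaloisRep.restrictField L₂ (FramedRep.conj P ρ)) := by
  have h₂ : FramedRep.IsAbsolutelyIrreducible
      (FramedGaloisRep.restrictField L₁ (FramedRep.conj P ρ)) := by
    rw [restrictField_conj]
    exact isAbsolutelyIrreducible_conj two_pos P h
  exact isAbsolutelyIrreducible_comp_of_range_subset two_pos (FramedRep.conj P ρ)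
    (absGaloisRestrict ℚ L₁) (absGaloisRestrict ℚ L₂)
    (range_absGaloisRestrict_sqrt_subset_cyclotomic L₁ L₂) h₂

/-- **D1 (PROVED, gen 4).** The stub's binder `IsAbsIrreducibleOverSqrt (-3)` gives FLS's
`ModPImageAbsIrreducibleOverCyclotomic W 3`. [folklore] -/
theorem modPImageAbsIrreducibleOverCyclotomic_three_of_isAbsIrreducibleOverSqrt
    (W : WeierstrassCurve ℚ) [W.IsElliptic] (ρ : ModPGaloisRep ℚ (ZMod 3) 2)
    (hρ : W.IsTorsionGaloisRep 3 ρ) (hirr : ρ.IsAbsIrreducibleOverSqrt (-3)) :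
    ModPImageAbsIrreducibleOverCyclotomic W 3 := by
  intro ρ' hρ' L _ _ _
  obtain ⟨P, rfl⟩ := hρ.exists_conj_eq hρ'
  exact @isAbsolutelyIrreducible_restrictField_cyclotomic_of_sqrt
    (X ^ 2 - C (-3 : ℚ) : ℚ[X]).SplittingField _ (_) (IsSplittingField.splittingField _) L _ _ _ ρ P
    (@hirr (X ^ 2 - C (-3 : ℚ) : ℚ[X]).SplittingField _ (_) (IsSplittingField.splittingField _))

open WeierstrassCurve in
/-- **B4 (PROVED, gen 4).** Integral model. [folklore] -/
theorem exists_integralModel (W : WeierstrassCurve ℚ) [W.IsElliptic] :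
    ∃ (E : WeierstrassCurve (𝓞 ℚ)) (C : WeierstrassCurve.VariableChange ℚ)
      (_ : (E.baseChange ℚ).IsElliptic), E.Δ ≠ 0 ∧ C • W = E.baseChange ℚ := by
  obtain ⟨C, hC⟩ := hasGlobalMinimalModel_rat_holds W
  haveI := hC
  refine ⟨(C • W).integralModel (𝓞 ℚ), C, ?_, IsGloballyMinimal.Δ_ne_zero (C • W), ?_⟩
  · rw [baseChange_integralModel_eq (𝓞 ℚ) (C • W)]; infer_instance
  · rw [baseChange_integralModel_eq (𝓞 ℚ) (C • W)]

/-- `BCDT.IsModular W` read at any level equal to `N_W`. [folklore] -/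
theorem isModular_iff_exists_isNewformOf_of_eq (W : WeierstrassCurve ℚ)
    [NeZero (W.conductorNorm ℤ)] {N : ℕ} [NeZero N] (h : W.conductorNorm ℤ = N) :
    BCDT.IsModular W ↔ ∃ f : CuspForm (CongruenceSubgroup.Gamma0 N) 2, IsNewformOf W f := by
  subst h
  rfl

/-- **B6 core (PROVED, gen 4).** Modularity is model-independent. [folklore] -/
theorem isModular_smul_iff (W : WeierstrassCurve ℚ) [W.IsElliptic]
    (C : WeierstrassCurve.VariableChange ℚ) [NeZero (W.conductorNorm ℤ)]
    [NeZero ((C • W).conductorNorm ℤ)] : BCDT.IsModular (C • W) ↔ BCDT.IsModular W := by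
  rw [isModular_iff_exists_isNewformOf_of_eq (C • W) (W.conductorNorm_smul_rat C)]
  refine exists_congr fun f ↦ ?_
  simp only [IsNewformOf, WeierstrassCurve.LFunction_smul]

/-- **B6 (PROVED, gen 4).** [folklore] -/
theorem isModular_of_smul_eq (W : WeierstrassCurve ℚ) [W.IsElliptic] [NeZero (W.conductorNorm ℤ)]
    (C : WeierstrassCurve.VariableChange ℚ) (W' : WeierstrassCurve ℚ) [NeZero (W'.conductorNorm ℤ)]
    (hCW : C • W = W') : BCDT.IsModular W' → BCDT.IsModular W := by
  subst hCW
  exact (isModular_smul_iff W C).mp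

/-! ## §2  The fact-web edge W1: `FLS2015_theorem3 → B3 → IsModularOfAbsIrrThree → CDT_theorem_7_2_1` -/

/-- **B3 (L; verbatim gen 3/4 and sibling k2): adelic ⇒ classical over `ℚ`.** Split in §3. -/
def IsModularOfAutomorphicRat : Prop :=
  ∀ (E : WeierstrassCurve (𝓞 ℚ)) [(E.baseChange ℚ).IsElliptic]
    [NeZero ((E.baseChange ℚ).conductorNorm ℤ)],
    E.Δ ≠ 0 → IsAutomorphicOfWeightZero E → BCDT.IsModular (E.baseChange ℚ)

/-- What the FLS road REALLY outputs at `ℓ = 3` (no condition at `3`, no residual modularity):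
every elliptic `W/ℚ` with `W[3]|_{ℚ(√-3)}` absolutely irreducible is modular.  Strictly between
`CDT_theorem_7_2_1` (which adds `27 ∤ N`) and BCDT Thm A. [cite: FreitasLeHungSiksek2015, Thm. 3] -/
def IsModularOfAbsIrrThree : Prop :=
  ∀ (W : WeierstrassCurve ℚ) [W.IsElliptic] [NeZero (W.conductorNorm ℤ)]
    (ρ : ModPGaloisRep ℚ (ZMod 3) 2),
    W.IsTorsionGaloisRep 3 ρ → ρ.IsAbsIrreducibleOverSqrt (-3) → BCDT.IsModular W

/-- **W1a (PROVED) = gen 4's closer D minus its last token.** [cite: FreitasLeHungSiksek2015, Thm. 3] -/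
theorem isModularOfAbsIrrThree_of_FLS2015_theorem3 (h : FLS2015_theorem3)
    (hB3 : IsModularOfAutomorphicRat) : IsModularOfAbsIrrThree := by
  intro W _ _ ρ hρ hirr
  obtain ⟨E, C, _, hΔ, hCW⟩ := exists_integralModel W
  haveI : NeZero ((E.baseChange ℚ).conductorNorm ℤ) :=
    ⟨(WeierstrassCurve.conductorNorm_pos_holds (E.baseChange ℚ)).ne'⟩
  have himgW : ModPImageAbsIrreducibleOverCyclotomic W 3 :=
    modPImageAbsIrreducibleOverCyclotomic_three_of_isAbsIrreducibleOverSqrt W ρ hρ hirr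
  have himgE : ModPImageAbsIrreducibleOverCyclotomic (E.baseChange ℚ) 3 := by
    intro ρ' hρ' L _ _ _
    have hW : W.IsTorsionGaloisRep 3 ρ' := by
      have h' := MatarNekovar2019.isTorsionGaloisRep_smul (E.baseChange ℚ) C⁻¹ hρ'
      rwa [← hCW, inv_smul_smul] at h'
    exact himgW ρ' hW L
  have hE : IsAutomorphicOfWeightZero E := h ℚ E hΔ 3 (Or.inl rfl) himgE
  exact isModular_of_smul_eq W C (E.baseChange ℚ) hCW (hB3 E hΔ hE)

/-- **W1b (PROVED).** The edge into the SEAT (`27 ∤ N_E` unused). Landable as a Literature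
`…Proofs` edge so that any FLS-side discharge propagates to every consumer of `CDT_theorem_7_2_1`.
[cite: ConradDiamondTaylor1999, Thm. 7.2.1] -/
theorem CDT_theorem_7_2_1_of_isModularOfAbsIrrThree (h : IsModularOfAbsIrrThree) :
    CDT_theorem_7_2_1 :=
  fun W _ _ ρ hρ hirr _ ↦ h W ρ hρ hirr

/-- **W1 (PROVED): `FLS2015_theorem3 → B3 → CDT_theorem_7_2_1`.** [cite: FreitasLeHungSiksek2015, Thm. 3] -/
theorem CDT_theorem_7_2_1_of_FLS2015_theorem3 (h : FLS2015_theorem3) (hB3 : IsModularOfAutomorphicRat) :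
    CDT_theorem_7_2_1 :=
  CDT_theorem_7_2_1_of_isModularOfAbsIrrThree (isModularOfAbsIrrThree_of_FLS2015_theorem3 h hB3)

/-- And hence the stub (PROVED modulo the named fact + B3). -/
theorem stub_liftThree_of_FLS2015_theorem3 (h : FLS2015_theorem3) (hB3 : IsModularOfAutomorphicRat) :
    SigStubLiftThree :=
  stub_liftThree_of_CDT_theorem_7_2_1 (CDT_theorem_7_2_1_of_FLS2015_theorem3 h hB3)

/-! ## §3 (NEW, gen 6)  N1 — the Fouquet–Wan `R_Σ(ρ̄) ≅ T^Σ_𝔪` interface does not seat the stub at `p = 3`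

`FouquetWan2021Assumption21 3 ρ̄` clause (2), in the tree's absolute transcription, asks, for EVERY
extension of scalars `f : k →+* k'`, frame `P` and characters `χ₁ χ₂ : Γ_{ℚ₃} → k'ˣ` making
`P⁻¹ f(ρ̄|G₃) P` upper triangular with diagonal `(χ₁, χ₂)`, that `χ₁⁻¹χ₂ ≠ 1` and `χ₁⁻¹χ₂ ≠ χ̄_cyc|G₃`.
Take `k' = k = ZMod 3`, `f = ι' = id`: in `(ZMod 3)ˣ = {±1}` inversion is the identity, so
`χ₁⁻¹χ₂ = χ₁χ₂ = det = χ̄₃` and the second inequation fails. -/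

/-- **N1a (PROVED).** Every unit of `𝔽₃` is its own inverse (`(ZMod 3)ˣ` has order `φ(3) = 2`).
[folklore] -/
theorem units_zmod_three_inv_eq_self (a : (ZMod 3)ˣ) : a⁻¹ = a := by
  have h : a * a = 1 := by
    have h2 := ZMod.pow_totient a
    rwa [Nat.totient_prime Nat.prime_three, pow_two] at h2
  exact inv_eq_of_mul_eq_one_left h

/-- **N1b (PROVED).** Hence for characters with values in `(ZMod 3)ˣ`, `χ₁⁻¹ χ₂ = χ₁ χ₂`. [folklore] -/
theorem inv_mul_eq_mul_of_zmod_three {G : Type*} [MulOneClass G] (χ₁ χ₂ : G →* (ZMod 3)ˣ) :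
    χ₁⁻¹ * χ₂ = χ₁ * χ₂ := by
  ext1 g
  simp only [MonoidHom.mul_apply, MonoidHom.inv_apply, units_zmod_three_inv_eq_self]

/-- **N1c (PROVED).** If `ρ̄|G₃` (`ρ̄ : Γ_ℚ → GL₂(𝔽₃)`) is upper triangular in some `𝔽₃`-frame `P` at a
place `v ∣ 3` with diagonal characters `χ₁, χ₂` satisfying `χ₁χ₂ = χ̄₃|G₃`, then `ρ̄` violates
Fouquet–Wan's Assumption 2.1 (clause (2) at `k' = 𝔽₃`, `f = ι' = id`: `χ₁⁻¹χ₂ = χ̄_cyc`).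
[cite: FouquetWan2021, Assumption 2.1 (p. 13)] -/
theorem not_fouquetWan2021Assumption21_three (ρbar : ModPGaloisRep ℚ (ZMod 3) 2)
    (v : HeightOneSpectrum (𝓞 ℚ)) (hv : ((3 : ℕ) : 𝓞 ℚ) ∈ v.asIdeal) (P : GL (Fin 2) (ZMod 3))
    (χ₁ χ₂ : Field.absoluteGaloisGroup (v.adicCompletion ℚ) →* (ZMod 3)ˣ)
    (htri : ∀ g : Field.absoluteGaloisGroup (v.adicCompletion ℚ),
      ((P⁻¹ * Matrix.GeneralLinearGroup.map (RingHom.id (ZMod 3)) (ρbar.toLocal v g) * P :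
          GL (Fin 2) (ZMod 3)) : Matrix (Fin 2) (Fin 2) (ZMod 3)) 1 0 = 0 ∧
        ((P⁻¹ * Matrix.GeneralLinearGroup.map (RingHom.id (ZMod 3)) (ρbar.toLocal v g) * P :
          GL (Fin 2) (ZMod 3)) : Matrix (Fin 2) (Fin 2) (ZMod 3)) 0 0 = (χ₁ g : ZMod 3) ∧
        ((P⁻¹ * Matrix.GeneralLinearGroup.map (RingHom.id (ZMod 3)) (ρbar.toLocal v g) * P :
          GL (Fin 2) (ZMod 3)) : Matrix (Fin 2) (Fin 2) (ZMod 3)) 1 1 = (χ₂ g : ZMod 3))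
    (hdet : ∀ g : Field.absoluteGaloisGroup (v.adicCompletion ℚ),
      χ₁ g * χ₂ g = modPCyclotomicCharacterZMod ℚ 3 (absGaloisRestrict ℚ (v.adicCompletion ℚ) g)) :
    ¬ FouquetWan2021Assumption21 3 ρbar := by
  rintro ⟨-, h2⟩
  refine (h2 v hv (ZMod 3) (RingHom.id _) (RingHom.id _) P χ₁ χ₂ htri).2 ?_
  ext1 g
  rw [inv_mul_eq_mul_of_zmod_three, MonoidHom.mul_apply, hdet g]
  apply Units.ext
  simp only [MonoidHom.comp_apply, Units.coe_map, MonoidHom.coe_coe, RingHom.id_apply,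
    ContinuousMonoidHom.coe_toMonoidHom]

/-- **N1d (PROVED modulo nothing: the determinant comes from the tree's PROVED
`det_eq_modPCyclotomicCharacter_of_isTorsionGaloisRep_holds`).** For a framed model `ρ̄` of `E[3]`,
an upper-triangular `𝔽₃`-frame of `ρ̄|G₃` at `v ∣ 3` (which exists whenever `E` is ordinary or
multiplicative at `3`, Serre 1972 §1.11–§1.12 — not typed here) already violates Assumption 2.1:
so `UniversalDeformationHeckeAlgebra.nonempty` is not an import seat for `stub_liftThree`, whose
`9 ∤ N_E` admits every such curve. [cite: FouquetWan2021, Assumption 2.1 (p. 13)] -/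
theorem not_fouquetWan2021Assumption21_three_of_isTorsionGaloisRep (W : WeierstrassCurve ℚ)
    [W.IsElliptic] (ρbar : ModPGaloisRep ℚ (ZMod 3) 2) (hρ : W.IsTorsionGaloisRep 3 ρbar)
    (v : HeightOneSpectrum (𝓞 ℚ)) (hv : ((3 : ℕ) : 𝓞 ℚ) ∈ v.asIdeal) (P : GL (Fin 2) (ZMod 3))
    (χ₁ χ₂ : Field.absoluteGaloisGroup (v.adicCompletion ℚ) →* (ZMod 3)ˣ)
    (htri : ∀ g : Field.absoluteGaloisGroup (v.adicCompletion ℚ),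
      ((P⁻¹ * Matrix.GeneralLinearGroup.map (RingHom.id (ZMod 3)) (ρbar.toLocal v g) * P :
          GL (Fin 2) (ZMod 3)) : Matrix (Fin 2) (Fin 2) (ZMod 3)) 1 0 = 0 ∧
        ((P⁻¹ * Matrix.GeneralLinearGroup.map (RingHom.id (ZMod 3)) (ρbar.toLocal v g) * P :
          GL (Fin 2) (ZMod 3)) : Matrix (Fin 2) (Fin 2) (ZMod 3)) 0 0 = (χ₁ g : ZMod 3) ∧
        ((P⁻¹ * Matrix.GeneralLinearGroup.map (RingHom.id (ZMod 3)) (ρbar.toLocal v g) * P :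
          GL (Fin 2) (ZMod 3)) : Matrix (Fin 2) (Fin 2) (ZMod 3)) 1 1 = (χ₂ g : ZMod 3)) :
    ¬ FouquetWan2021Assumption21 3 ρbar := by
  refine not_fouquetWan2021Assumption21_three ρbar v hv P χ₁ χ₂ htri fun g ↦ ?_
  obtain ⟨h10, h00, h11⟩ := htri g
  haveI : NeZero ((3 : ℕ) : ℚ) := ⟨by norm_num⟩
  have hdet := WeierstrassCurve.det_eq_modPCyclotomicCharacter_of_isTorsionGaloisRep_holds W 3 ρbar
    hρ (absGaloisRestrict ℚ (v.adicCompletion ℚ) g)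
  -- `det (P⁻¹ ρ̄(g) P) = det ρ̄(g)` in the commutative group `(ZMod 3)ˣ`
  have hconj : Matrix.GeneralLinearGroup.det
      (P⁻¹ * Matrix.GeneralLinearGroup.map (RingHom.id (ZMod 3)) (ρbar.toLocal v g) * P) =
      Matrix.GeneralLinearGroup.det (ρbar (absGaloisRestrict ℚ (v.adicCompletion ℚ) g)) := by
    rw [map_mul, map_mul, map_inv, Matrix.GeneralLinearGroup.map_id, MonoidHom.id_apply,
      FramedGaloisRep.toLocal_apply, mul_comm (Matrix.GeneralLinearGroup.det P)⁻¹, inv_mul_cancel_right]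
  rw [← hdet, ← hconj]
  apply Units.ext
  rw [Units.val_mul, Matrix.GeneralLinearGroup.val_det_apply, Matrix.det_fin_two, h10, h00, h11,
    mul_zero, sub_zero]

/-- **N2 (PROVED) — the positive half of the dictionary.** At `p = 3`, `p* = -3` and Fouquet–Wan's
group `G_{ℚ(√p*)}` (`galSqrtPStar 3 = ker χ̄₃^{(3-1)/2} = ker χ̄₃`) is exactly `Γ_{ℚ(ζ₃)} = Γ_{ℚ(√-3)}`,
the group of the stub's binder `IsAbsIrreducibleOverSqrt (-3)` (cf. R0): clause (1) of Assumption 2.1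
is the stub's irreducibility hypothesis on the nose, so clause (2) (N1) and the absent classicality
field are the whole obstruction. [cite: FouquetWan2021, Assumption 2.1 (p. 13)] -/
theorem mem_galSqrtPStar_three_iff_mem_range (L : Type*) [Field L] [Algebra ℚ L]
    [IsCyclotomicExtension {3} ℚ L] (γ : Field.absoluteGaloisGroup ℚ) :
    γ ∈ galSqrtPStar 3 ↔ γ ∈ (absGaloisRestrict ℚ L).range := by
  haveI : NeZero ((3 : ℕ) : ℚ) := ⟨by norm_num⟩
  rw [mem_galSqrtPStar_iff, mem_range_absGaloisRestrict_cyclotomic_iff 3 L γ]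
  norm_num

end Summit.ABC.ABC.Cruxes.FreyModularity.Sketch.StubIdeas1g6

end
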